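import Literature.AlgebraicGeometry.Resolution.HironakaDirectrix
import Mathlib.Algebra.MvPolynomial.Variables
import HarnessLib

/-!
# `τ(F) ≤ #vars(F)`: translations along absent variables fix a form

Topic: `Literature/AlgebraicGeometry/Resolution`.  Companion to `HironakaDirectrix` ([CoP1] =
Cossart–Piltant 2008, proof of Prop. 4.2; [CJS] = Cossart–Jannsen–Saito 2020, Lemma 2.7 / Def. 2.8:
`𝒯(I)` is the SMALLEST subspace of linear forms with `I` generated in `k[𝒯(I)]`, `e = n − dim 𝒯(I)`;
Remark 2.9 (c): `Dir_K(A[X]) ≅ Dir_K(A) × 𝔸¹`).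

The elementary UPPER bound by the variables that occur: if `w` vanishes on `vars F` then
`F(Y + wT) = F(Y)` (`translate_rename_eq_of_forall_vars`), so the coordinate subspace
`{w | ∀ i ∈ vars F, w i = 0}` lies in Hironaka's invariance space `𝕎({F})`
(`vanishingOn_vars_le_invarianceSpace`), and counting dimensions

  `τ({F}) ≤ (vars F).card`      (`hironakaTau_le_card_vars`).

Together with the polar LOWER bound of `HironakaDirectrixPolar` (`dim ⟨∂ᵢF⟩ ≤ τ({F})`) this pins `τ`
in the kernel for every form whose gradient span has rank equal to the number of occurring variables
— e.g. every diagonal form `Σ_{i<c} aᵢ Yᵢ^ν` with `ν, aᵢ ≠ 0` in `k`, and the census's `Y₀² + Y₁²` in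
characteristic `≠ 2` (`τ = 2`).  Instrument lemma for the resolution observatory (pub-rosobs, carver
g38); NOT summit progress.
-/

noncomputable section

open MvPolynomial

namespace Literature.AlgebraicGeometry.Resolution

universe u

section CommRing

variable (k : Type u) [CommRing k] {d : ℕ}

/-- **Translations along absent variables fix `F`**: if `w i = 0` for every variable `Y_i` occurring
in `F` then `F(Y + wT) = F(Y)`. [cite: CossartJannsenSaito2020, Remark 2.9 (c) (Dir(A[X]) = Dir(A) × 𝔸¹)] -/
theorem translate_rename_eq_of_forall_vars (w : Fin d → k) (F : MvPolynomial (Fin d) k)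
    (h : ∀ i ∈ F.vars, w i = 0) :
    translate k w (rename some F) = rename some F := by
  have := MvPolynomial.hom_congr_vars
    (f₁ := ((translate k w).comp (rename some)).toRingHom)
    (f₂ := (rename some : MvPolynomial (Fin d) k →ₐ[k] MvPolynomial (Option (Fin d)) k).toRingHom)
    (p₁ := F) (p₂ := F) (by ext a; simp) (fun i hi _ => by simp [h i hi]) rfl
  simpa using this

end CommRing

section Field

variable (k : Type u) [Field k] {d : ℕ}

/-- The coordinate subspace of vectors vanishing on a set of indices `s`, as the kernel of the
restriction map `k^d → k^s`. [cite: CossartJannsenSaito2020, Remark 2.9 (c)] -/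
def vanishingOn (s : Finset (Fin d)) : Submodule k (Fin d → k) :=
  LinearMap.ker (LinearMap.pi fun i : s => LinearMap.proj (i : Fin d))

/-- Membership in `vanishingOn s`. [cite: CossartJannsenSaito2020, Remark 2.9 (c)] -/
theorem mem_vanishingOn_iff {s : Finset (Fin d)} {w : Fin d → k} :
    w ∈ vanishingOn k s ↔ ∀ i ∈ s, w i = 0 := by
  simp only [vanishingOn, LinearMap.mem_ker, LinearMap.pi_apply, LinearMap.coe_proj,
    Function.eval, funext_iff, Pi.zero_apply, Subtype.forall]

/-- `dim (vanishingOn s) + #s = d` (the restriction map is onto). [cite: CossartJannsenSaito2020,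
Remark 2.9 (c)] -/
theorem finrank_vanishingOn_add_card (s : Finset (Fin d)) :
    Module.finrank k (vanishingOn k s) + s.card = d := by
  classical
  set f : (Fin d → k) →ₗ[k] (s → k) := LinearMap.pi fun i : s => LinearMap.proj (i : Fin d) with hf
  have hsurj : Function.Surjective f := by
    intro v
    refine ⟨fun i => if hi : i ∈ s then v ⟨i, hi⟩ else 0, ?_⟩
    funext i
    simp [hf, i.2]
  have hrange : Module.finrank k (LinearMap.range f) = s.card := by
    rw [LinearMap.range_eq_top.2 hsurj, finrank_top, Module.finrank_fintype_fun_eq_card,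
      Fintype.card_coe]
  have := LinearMap.finrank_range_add_finrank_ker f
  rw [Module.finrank_fin_fun, hrange] at this
  show Module.finrank k (LinearMap.ker f) + s.card = d
  omega

/-- **The coordinate subspace along the absent variables lies in `𝕎({F})`.**
[cite: CossartPiltant2008, proof of Prop. 4.2 (intrinsic definition of the directrix);
CossartJannsenSaito2020, Remark 2.9 (c)] -/
theorem vanishingOn_vars_le_invarianceSpace (F : MvPolynomial (Fin d) k) :
    vanishingOn k F.vars ≤ invarianceSpace k ({F} : Set (MvPolynomial (Fin d) k)) := by
  intro w hw
  rw [mem_invarianceSpace_iff]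
  rintro G rfl
  exact translate_rename_eq_of_forall_vars k w G ((mem_vanishingOn_iff k).1 hw)

/-- **`τ({F}) ≤ #vars(F)`**: Hironaka's `τ` of a single polynomial is at most the number of variables
occurring in it. [cite: CossartPiltant2008, proof of Prop. 4.2 (τ := dim T, T minimal with
F ∈ k[T]); CossartJannsenSaito2020, Lemma 2.7, Def. 2.8, Remark 2.9 (c)] -/
theorem hironakaTau_le_card_vars (F : MvPolynomial (Fin d) k) :
    hironakaTau k ({F} : Set (MvPolynomial (Fin d) k)) ≤ F.vars.card := by
  have h1 := finrank_vanishingOn_add_card k F.vars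
  have h2 : Module.finrank k (vanishingOn k F.vars) ≤
      Module.finrank k (invarianceSpace k ({F} : Set (MvPolynomial (Fin d) k))) :=
    Submodule.finrank_mono (vanishingOn_vars_le_invarianceSpace k F)
  have h3 := hironakaTau_add_finrank_invarianceSpace k ({F} : Set (MvPolynomial (Fin d) k))
  omega

/-- The census instance: `τ(Y₀² + Y₁²) ≤ 2` in `k[Y₀, Y₁, Y₂]` over any field (only `Y₀, Y₁`
occur). [cite: CossartJannsenSaito2020, Remark 2.9 (c)] -/
theorem hironakaTau_sq_add_sq_le_card_vars :
    hironakaTau k ({X 0 ^ 2 + X 1 ^ 2} : Set (MvPolynomial (Fin 3) k)) ≤ 2 := by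
  refine le_trans (hironakaTau_le_card_vars k _) ?_
  classical
  refine le_trans (Finset.card_le_card (vars_add_subset _ _)) ?_
  refine le_trans (Finset.card_union_le _ _) ?_
  have h0 : (X 0 ^ 2 : MvPolynomial (Fin 3) k).vars.card ≤ 1 :=
    le_trans (Finset.card_le_card (vars_pow _ _)) (by rw [vars_X]; simp)
  have h1 : (X 1 ^ 2 : MvPolynomial (Fin 3) k).vars.card ≤ 1 :=
    le_trans (Finset.card_le_card (vars_pow _ _)) (by rw [vars_X]; simp)
  omega

end Field

end Literature.AlgebraicGeometry.Resolution

end
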